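import Summits.CriticalPhenomena.PercolationContinuityZ3.Theorems.Transplant.HexShadowVRouteData
import HarnessLib

/-!
# HEXAGONAL SHADOWS — SHAPED LOCAL LINKAGE WITH THE EXIT PROPERTY OF THE WITNESS (the node `ShapedLinkageX R` for hexagonal shadows; port of «SqShadowVRouteDataX»)

builds on p205010 (kernel theorem, internal audit signed; external expert review pending) — NOT used in this file.  Lane `prim-bschramm`, seat `prim-bschramm-p2` (gen 47; class C1b;
memo `HOME/bschramm/P2-LATTICES.md` §158); helper file (`--supports stmt-CriticalPhenomena-4575 --as helper`).

WHY.  The instance obligation `ShapedLinkage R` («HexShadowVRouteData») quantifies over every exit vertex `w' ∈ W` off three columns.  For the bcc (111)-films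
`F_m(bcc)` («Bcc111FilmHexShadow», `m ≥ 3`) this is unsatisfiable for the natural cleared sets: STACKED terminals `E₁ = (A, 0)`, `E₂ = (A, 3)` (an elevator pair) over a
boundary column `A` of the hexagon whose only other block-neighbour column carries `w'` admit no swap pair (memo §158 (3): the witnesses `((−3,0),0), ((−3,0),3), ((−2,0),1)`
for the full lift and `((−3,1),0), ((−3,1),3), ((−2,1),1)` for the lift minus the corner columns).  As for the thin square-shadow films («SqShadowVRouteDataX», gen 42) what
the generic routing actually produces is sharper: `w'` is the LAST vertex of the `(P2)`-witness `π` in `W`, so — unless `π` ends inside `W` — `w'` has a neighbour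
`x ∉ W` (the next vertex of `π`) inside the cleared window `{ξ ≤ ξ(z) + t_D, ξ + η ≤ ξ(z) + η(z) + s_D}` and off the columns of `γ_min ⊇ {z, E₁, E₂}`; the cornered
exits above have no such neighbour.  This file records that EXIT PROPERTY as an extra field, verbatim the square twin:
* §1 **`HexShadow.TerminalsX`** (`Terminals` + the exit neighbour) and the node **`HexShadow.ShapedLinkageX R`** (the same swap-pair obligation, for `TerminalsX`-certified
  triples only); `shapedLinkageX_of_shapedLinkage` (the old node implies the new one);
* §2 `exists_W_of_shapedLinkageX` (the keyed routing from the swap pair).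
The consumer (the twin of «SqShadowVRoutingX»: located surgeries and the Gluing Lemma from `ShapedLinkageX R`, given inhabited columns and connected lifts of hexagons)
is the next file of the bcc (111) line.  Internal obligations, never asserted.
[cite: DuminilCopinSidoraviciusTassion2016, §2.3 (proof of Fact 2: "Choose w' on the boundary of B̄_R in such a way that there exists an open self-avoiding path π from w' to
S̄'_n, all the edges of which lie outside B̄_R(z)")]
-/

noncomputable section

namespace Summit.CriticalPhenomena.PercolationContinuityZ3.Theorems.Transplant

open MeasureTheory Literature.Probability.Percolation Literature.Probability.LatticeModels SimpleGraph Filter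
open scoped Classical Topology

/-! ## §1 Terminals with the exit property; the node -/

/-- **The terminal data WITH THE EXIT PROPERTY of `w'`** (hexagonal shadows): `Terminals R z t_R t_D s_R W E₁ E₂ w'` and a neighbour `x ∉ W` of `w'` over the cleared
window `{ξ ≤ ξ(z) + t_D} ∩ {ξ + η ≤ ξ(z) + η(z) + s_D}`, off the columns of `z`, `E₁`, `E₂` (DST: `w'` on the boundary of `B̄_R(z)`, the path `π` leaving the ball at once).
[cite: DuminilCopinSidoraviciusTassion2016, §2.3 (proof of Fact 2: u', v', w' and the path π)] -/
structure HexShadow.TerminalsX {V : Type} {G : SimpleGraph V} (Φ : HexShadow G) (R : ℕ) (z : Site 2) (tR tD sR sD : ℕ) (W : Set V) (E₁ E₂ w' : V) : Prop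
    extends Φ.Terminals R z tR tD sR W E₁ E₂ w' where
  w'x : ∃ x : V, G.Adj w' x ∧ x ∉ W ∧ HexShadow.InWin z tD sD (Φ.sh x) ∧ Φ.sh x ≠ z ∧ Φ.sh x ≠ Φ.sh E₁ ∧ Φ.sh x ≠ Φ.sh E₂

/-- **NODE (instance obligation) — SHAPED LOCAL LINKAGE with surgery radius `R`, EXIT form, hexagonal shadows.**  As `ShapedLinkage R`, but the swap pair is owed
only for terminal triples certified by `TerminalsX` (the exit vertex `w'` has a neighbour outside the cleared set, inside the cleared window, off the columns of
`z, E₁, E₂`).  Internal obligation, never asserted; aimed at the fat bcc (111)-films (memo §158). [cite: DuminilCopinSidoraviciusTassion2016, §2.3 (proof of Fact 2, p. 6: the choice of R)] -/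
def HexShadow.ShapedLinkageX {V : Type} {G : SimpleGraph V} (Φ : HexShadow G) (R : ℕ) : Prop :=
  ∀ (z : Site 2) (tR tD sR sD : ℕ), tR ≤ tD → sR ≤ sD → (R ≤ tR ∨ R ≤ sR) →
    ∃ W : Set V, (∀ x ∈ W, Φ.sh x ∈ blkR R z tD sD) ∧ (∀ x, Φ.sh x ∈ hexBall z 1 → Φ.sh x ∈ blkR R z tD sD → x ∈ W) ∧
      ∀ (E₁ E₂ w' : V), Φ.TerminalsX R z tR tD sR sD W E₁ E₂ w' →
        ∃ r₁ r₂ : VRouteData G (W ∩ Φ.lift (blkR R z tR sR)) W E₁ E₂ w', r₁.y = r₂.b ∧ r₁.b = r₂.y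

namespace HexShadow

variable {V : Type} {G : SimpleGraph V} (Φ : HexShadow G)

/-- The node `ShapedLinkage R` implies its exit form (forget the exit neighbour). [folklore] -/
theorem shapedLinkageX_of_shapedLinkage {R : ℕ} (hL : Φ.ShapedLinkage R) : Φ.ShapedLinkageX R := by
  intro z tR tD sR sD htRD hsRD hone
  obtain ⟨W, hW1, hW2, hW3⟩ := hL z tR tD sR sD htRD hsRD hone
  exact ⟨W, hW1, hW2, fun E₁ E₂ w' hT => hW3 E₁ E₂ w' hT.toTerminals⟩

/-! ## §2 The keyed routing from a swap pair -/

/-- **The cleared set and the keyed routing under `ShapedLinkageX`.** [cite: DuminilCopinSidoraviciusTassion2016, §2.3, proof of Fact 2] -/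
theorem exists_W_of_shapedLinkageX [Countable V] {R : ℕ} (hL : Φ.ShapedLinkageX R) (z : Site 2) {tR tD sR sD : ℕ} (htRD : tR ≤ tD) (hsRD : sR ≤ sD)
    (hone : R ≤ tR ∨ R ≤ sR) :
    ∃ W : Set V, (∀ x ∈ W, Φ.sh x ∈ blkR R z tD sD) ∧ (∀ x, Φ.sh x ∈ hexBall z 1 → Φ.sh x ∈ blkR R z tD sD → x ∈ W) ∧
      ∀ (E₁ E₂ w' : V), Φ.TerminalsX R z tR tD sR sD W E₁ E₂ w' →
        ∃ r : VRouteData G (W ∩ Φ.lift (blkR R z tR sR)) W E₁ E₂ w', vtxKey V r.y < vtxKey V r.b := by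
  obtain ⟨W, hW1, hW2, hW3⟩ := hL z tR tD sR sD htRD hsRD hone
  refine ⟨W, hW1, hW2, fun E₁ E₂ w' hT => ?_⟩
  obtain ⟨r₁, r₂, hy, hb⟩ := hW3 E₁ E₂ w' hT
  exact VRouteData.exists_key r₁ r₂ hy hb

end HexShadow

end Summit.CriticalPhenomena.PercolationContinuityZ3.Theorems.Transplant

end
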